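import Summits.BirchSwinnertonDyer.BirchSwinnertonDyer.Theorems.ByReductionTypeAtTwoMultTransportTwistedLiftUnramified
import Summits.BirchSwinnertonDyer.Rank1Residual.Additive.UnramifiedAwayBadPlaces
import Literature.NumberTheory.EllipticCurves.ZpExtensionGaloisTwistWeilDual
import Literature.NumberTheory.EllipticCurves.ZpExtensionGaloisTwistSelmerStructure
import Literature.NumberTheory.EllipticCurves.IwasawaSelmer
import Literature.NumberTheory.GaloisCohomology.PoitouTateSelmerStructures
import HarnessLib

/-!
# T-42-mult in the kernel, XXIII: DUAL-SIDE CONTROL — a dual Selmer class of `H¹_{𝓕^*}(K, E[p^J](χ_u)^D)`,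
# read in `E[p^J](χ_{u'})` through the twisted Weil duality, maps into `Sel_{p^∞}(E/K_∞)`

Cell `bsd-2adic` (run/shared/lean/pub/bsd-2adic/), seat `bsd-2adic-t42` (BRIEF-T42), GEN 16. HONEST FRAMING:
research route; THEOREMS ONLY (no `def`, no named fact, no instance); nothing booked; nothing re-keyed
(RC-169); BSD is not proved by any of this. PARTITION: X5@2 multiplicative GV-transport rows (K4ᵐ B1·O1; the
residual `LIFT₃` of `hF3b`, file XXII `…TwistedDescentPT.lean`) × p = 2 — types-the-object-of; bears_on K4 items
19922 / 19923 (`--supports stmt-BirchSwinnertonDyer-19923`). Brick (δ) — the places in `S₀` and the good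
places — of HOME/t42/DESIGN-T42-ADDENDUM-17.md; the places above `p` and the infinite places enter as the two
displayed hypotheses `hδp`, `hδinf` (bricks (δ2), (δ∞), to be discharged).

## What

Greenberg (LNM 1716 p. 123): the cokernel of `γ'` is controlled by the dual Selmer group `S'_{T^*}(F)`, whose
classes restricted to `F_∞` lie in `S_{M^*}(F_∞) = Sel_E(F_∞)_p ⊗ κ^{-s}` (p. 124). At finite level
(`M_J = E[p^J](χ_u)`, Selmer structures `𝓕 ≤ 𝓖` of `ZpExtensionGaloisTwistSelmerStructure`, Weil duality
`w : E[p^J](χ_{u'}) ⥲ M_J^D` of `ZpExtensionGaloisTwistWeilDual`, `u u' ≡ 1 mod p^J`): for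
`y = H¹(w) y' ∈ H¹_{𝓕^*}(K, M_J^D)` and a family `inv` with `IsPerfect` and `UnramifiedOrthogonal`,

* at `v ∈ S₀` the dual condition is STRICT: `loc_v y = 0`, hence `loc_v y' = 0`
  (`localization_eq_zero_of_mem_dualSelmer`, `res_eq_zero_of_mem_dualSelmer`);
* at a finite `v ∉ S₀`, `v ∤ p`: `loc_v y ∈ H¹_ur(M_J^D)` (Milne I 2.6), so `loc_v y'` is unramified (transport
  through `w`, `res_mem_unramifiedSubgroup_of_mem_dualSelmer`), so `twistedTorsionToH1 y'` is unramified at `v`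
  over `K_∞` (file XX) and Kummer there (`Rank1Residual.Additive.unramKer_le_localKerOver_of_isCyclotomic`,
  cyclotomic tower, any reduction at `v ∤ p`);
* **`twistedTorsionToH1_mem_selmerInfty_of_mem_dualSelmer`**: if moreover the local classes of `y'` die in
  `H¹((K_∞)_w, E)` at the places above `p` (`hδp`) and at the infinite places (`hδinf`), then
  `twistedTorsionToH1 y' ∈ Sel_{p^∞}(E/K_∞)` (all conjugates by `conjH1_twistedTorsionToH1_mem`).

Generic plumbing proved here: `map_map_eq_self_of_leftInverse` (mutually inverse intertwining maps induce
mutually inverse maps on `H¹`), used for `w⁻¹ ∘ w` at the completions and at their maximal unramified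
extensions.

References: [GreenbergLNM1716] §4 pp. 122–126; [GreenbergVatsal2000] §2 pp. 16–17; [MilneADT2006] I Thm. 2.6.
-/

set_option autoImplicit false
set_option linter.dupNamespace false

noncomputable section

open scoped Classical ContRepresentation

universe u

/-! ## Generic: mutually inverse intertwining maps on `H¹` -/

namespace Literature.NumberTheory.GaloisRepresentations

variable {F : Type u} [Field F] {M N : Type u} [AddCommGroup M] [TopologicalSpace M] [DiscreteTopology M]
  [AddCommGroup N] [TopologicalSpace N] [DiscreteTopology N]
  {ρ : DiscreteGaloisModule F M} {ρ' : DiscreteGaloisModule F N}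

/-- If `g ∘ f = id` on points for continuous intertwining maps `f : M → N`, `g : N → M` of discrete Galois
modules, then `H¹(g) ∘ H¹(f) = id` on `H¹(Γ_F, M)` (functoriality on explicit cocycles).
[cite: SerreGaloisCohomology1997, I §2.2] -/
theorem map_map_eq_self_of_leftInverse
    (f : ρ.toContRepresentation →ⁱL ρ'.toContRepresentation)
    (g : ρ'.toContRepresentation →ⁱL ρ.toContRepresentation) (hgf : ∀ m, g (f m) = m)
    (x : galoisCohomology ρ 1) :
    galoisCohomology.map g 1 (galoisCohomology.map f 1 x) = x := by
  obtain ⟨ξ, rfl⟩ := oneCocycleClass_surjective _ x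
  rw [galoisCohomology.map_one_oneCocycleClass, galoisCohomology.map_one_oneCocycleClass]
  exact congrArg _ (Subtype.ext (ContinuousMap.ext fun σ ↦ hgf (ξ.1 σ)))

/-- Hence `H¹(f)` is injective when `f` has a left inverse `g`. [cite: SerreGaloisCohomology1997, I §2.2] -/
theorem map_injective_of_leftInverse
    (f : ρ.toContRepresentation →ⁱL ρ'.toContRepresentation)
    (g : ρ'.toContRepresentation →ⁱL ρ.toContRepresentation) (hgf : ∀ m, g (f m) = m) :
    Function.Injective (galoisCohomology.map f 1) := fun a b h ↦ by
  rw [← map_map_eq_self_of_leftInverse f g hgf a, ← map_map_eq_self_of_leftInverse f g hgf b, h]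

end Literature.NumberTheory.GaloisRepresentations

namespace Summit.BirchSwinnertonDyer.BirchSwinnertonDyer.Theorems.MultTransportTwistedDescent

open NumberField IsDedekindDomain Field WeierstrassCurve CategoryTheory
  Literature.NumberTheory.EllipticCurves Literature.NumberTheory.EllipticCurves.GreenbergVatsal2000
  Literature.NumberTheory.GaloisRepresentations Literature.NumberTheory.GaloisCohomology
open Literature.NumberTheory.GaloisRepresentations.DiscreteGaloisModule (localTatePairingZMod
  unramifiedSubgroup SelmerStructure TateDual)

variable {K : Type} [Field K] [NumberField K] (W : WeierstrassCurve K) [W.IsElliptic] (p : ℕ) [Fact p.Prime]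
  (κ : ZpExtension K p) (S₀ : Finset (HeightOneSpectrum (𝓞 K))) (J : ℕ) {u u' : ℤ}
  (hu : (p : ℤ) ∣ u - 1) (hu' : (p : ℤ) ∣ u' - 1) (huu' : ((p : ℤ) ^ J) ∣ u * u' - 1)
  (e : W.geomTorsion ((p ^ J : ℕ) : ℤ) → W.geomTorsion ((p ^ J : ℕ) : ℤ) → AlgebraicClosure K)
  (hμ : ∀ S T, e S T ^ (p ^ J) = 1)
  (hadd₁ : ∀ S₁ S₂ T, e (S₁ + S₂) T = e S₁ T * e S₂ T)
  (hadd₂ : ∀ S T₁ T₂, e S (T₁ + T₂) = e S T₁ * e S T₂)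
  (hgal : ∀ (σ : absoluteGaloisGroup K) (S T : W.geomTorsion ((p ^ J : ℕ) : ℤ)),
    σ • e S T = e (σ • S) (σ • T))
  (hnondeg : ∀ T, (∀ S, e S T = 1) → T = 0)
  [Finite (W.geomTorsion ((p ^ J : ℕ) : ℤ))]

/-! ## The strict places `v ∈ S₀` -/

omit [W.IsElliptic] in
/-- **At an omitted prime `v ∈ S₀` a dual Selmer class is locally TRIVIAL** (`𝓕_v = ⊤`, so `𝓕_v^* = 0` by
the perfectness of the local Tate pairing — Greenberg p. 123 «`U'^*_{v₀} = 0`»).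
[cite: GreenbergLNM1716, §4 p. 123] [cite: MilneADT2006, Ch. I, Cor. 2.3] -/
theorem localization_eq_zero_of_mem_dualSelmer {inv : LocalInvariants K (p ^ J)} (hperf : inv.IsPerfect)
    {y : galoisCohomology ((W.twistedTorsionGaloisModule p κ J u hu).tateDual (p ^ J)) 1}
    (hy : y ∈ (inv.dualSelmerStructure (W.twistedTorsionGaloisModule p κ J u hu)
      (W.twistedKummerSelmerStructure p S₀ κ J u hu)).selmerGroup)
    {v : HeightOneSpectrum (𝓞 K)} (hv : v ∈ S₀) :
    galoisCohomology.localization ((W.twistedTorsionGaloisModule p κ J u hu).tateDual (p ^ J))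
      (Sum.inr v) 1 y = 0 := by
  rw [SelmerStructure.mem_selmerGroup_iff] at hy
  have hyv := hy (Sum.inr v)
  rw [LocalInvariants.dualSelmerStructure_apply, W.twistedKummerSelmerStructure_inr_of_mem p S₀ κ J u hu hv,
    LocalInvariants.mem_dualLocalCondition_iff] at hyv
  have hinj := ((hperf v).2 (W.twistedTorsionGaloisModule p κ J u hu) (W.pow_nsmul_geomTorsion_pow p J)).2.1
  apply hinj
  rw [map_zero]
  exact AddMonoidHom.ext fun b ↦ by
    rw [AddMonoidHom.flip_apply, AddMonoidHom.zero_apply]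
    exact hyv b (AddSubgroup.mem_top b)

section Weil

variable [CharZero K]

include hnondeg

/-- The twisted class `y'` with `H¹(w) y' = y` is locally trivial at `v ∈ S₀` too (`H¹(w|_{K_v})` is injective:
`w⁻¹` is a pointwise inverse). [cite: GreenbergLNM1716, §4 p. 123] -/
theorem res_eq_zero_of_mem_dualSelmer {inv : LocalInvariants K (p ^ J)} (hperf : inv.IsPerfect)
    (y' : galoisCohomology (W.twistedTorsionGaloisModule p κ J u' hu') 1)
    (hy : galoisCohomology.map (W.twistedWeilDual p κ J hu hu' huu' e hμ hadd₁ hadd₂ hgal) 1 y' ∈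
      (inv.dualSelmerStructure (W.twistedTorsionGaloisModule p κ J u hu)
        (W.twistedKummerSelmerStructure p S₀ κ J u hu)).selmerGroup)
    {v : HeightOneSpectrum (𝓞 K)} (hv : v ∈ S₀) :
    galoisCohomology.res (W.twistedTorsionGaloisModule p κ J u' hu') (v.adicCompletion K) 1 y' = 0 := by
  have h0 := localization_eq_zero_of_mem_dualSelmer W p κ S₀ J hu hperf hy hv
  have h1 : galoisCohomology.map
      ((W.twistedWeilDual p κ J hu hu' huu' e hμ hadd₁ hadd₂ hgal).restrictField (v.adicCompletion K)) 1
      (galoisCohomology.res (W.twistedTorsionGaloisModule p κ J u' hu') (v.adicCompletion K) 1 y') = 0 := by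
    rw [← W.res_map_twistedWeilDual p κ J hu hu' huu' e hμ hadd₁ hadd₂ hgal (v.adicCompletion K) y']
    exact h0
  refine map_injective_of_leftInverse
    ((W.twistedWeilDual p κ J hu hu' huu' e hμ hadd₁ hadd₂ hgal).restrictField (v.adicCompletion K))
    ((W.twistedWeilDualInv p κ J hu hu' huu' e hμ hadd₁ hadd₂ hgal hnondeg).restrictField (v.adicCompletion K))
    (fun m ↦ W.twistedWeilDualInv_apply p κ J hu hu' huu' e hμ hadd₁ hadd₂ hgal hnondeg m) ?_
  rw [h1, map_zero]

/-! ## The good places `v ∉ S₀`, `v ∤ p` -/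

/-- **At a good place the dual class is unramified, and so is `y'`**: for a family with Milne I 2.6
(`UnramifiedOrthogonal`) the dual local condition of `H¹_ur(M_J)` is `H¹_ur(M_J^D)`; unramifiedness is the
vanishing of the restriction to `K_v^{ur}`, which commutes with `H¹(w)`, injective over `K_v^{ur}` as well.
[cite: MilneADT2006, Ch. I, Thm. 2.6] [cite: GreenbergLNM1716, §4 p. 124] -/
theorem res_mem_unramifiedSubgroup_of_mem_dualSelmer {inv : LocalInvariants K (p ^ J)}
    (hUO : inv.UnramifiedOrthogonal)
    (y' : galoisCohomology (W.twistedTorsionGaloisModule p κ J u' hu') 1)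
    (hy : galoisCohomology.map (W.twistedWeilDual p κ J hu hu' huu' e hμ hadd₁ hadd₂ hgal) 1 y' ∈
      (inv.dualSelmerStructure (W.twistedTorsionGaloisModule p κ J u hu)
        (W.twistedKummerSelmerStructure p S₀ κ J u hu)).selmerGroup)
    {v : HeightOneSpectrum (𝓞 K)} (hv : v ∉ S₀) (hpv : ((p : ℕ) : 𝓞 K) ∉ v.asIdeal)
    (hpJ : ((p ^ J : ℕ) : 𝓞 K) ∉ v.asIdeal)
    (hur : GaloisRep.IsUnramifiedAt v (W.twistedTorsionGaloisModule p κ J u hu)) :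
    galoisCohomology.res (W.twistedTorsionGaloisModule p κ J u' hu') (v.adicCompletion K) 1 y' ∈
      unramifiedSubgroup ((W.twistedTorsionGaloisModule p κ J u' hu').restrictField (v.adicCompletion K)) 1 := by
  set wJ := W.twistedWeilDual p κ J hu hu' huu' e hμ hadd₁ hadd₂ hgal with hwJ
  set wI := W.twistedWeilDualInv p κ J hu hu' huu' e hμ hadd₁ hadd₂ hgal hnondeg with hwI
  rw [SelmerStructure.mem_selmerGroup_iff] at hy
  have hyv := hy (Sum.inr v)
  rw [LocalInvariants.dualSelmerStructure_apply,
    W.twistedKummerSelmerStructure_inr_of_not_mem p S₀ κ J u hu hv hpv,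
    (hUO (W.twistedTorsionGaloisModule p κ J u hu) (W.pow_nsmul_geomTorsion_pow p J) v hpJ hur).1] at hyv
  -- `hyv : loc_v (H¹(w) y') ∈ H¹_ur(M_J^D)`, i.e. its restriction to `K_v^{ur}` vanishes
  replace hyv := (DiscreteGaloisModule.mem_unramifiedSubgroup_iff _ _ _).mp hyv
  refine (DiscreteGaloisModule.mem_unramifiedSubgroup_iff _ _ _).mpr ?_
  have h1 : galoisCohomology.localization ((W.twistedTorsionGaloisModule p κ J u hu).tateDual (p ^ J))
      (Sum.inr v) 1 (galoisCohomology.map wJ 1 y') =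
      galoisCohomology.map (wJ.restrictField (v.adicCompletion K)) 1
        (galoisCohomology.res (W.twistedTorsionGaloisModule p κ J u' hu') (v.adicCompletion K) 1 y') :=
    W.res_map_twistedWeilDual p κ J hu hu' huu' e hμ hadd₁ hadd₂ hgal (v.adicCompletion K) y'
  have h2 := galoisCohomology.res_map_one
    (IsNonarchimedeanLocalField.maxUnramified (v.adicCompletion K)) (wJ.restrictField (v.adicCompletion K))
    (galoisCohomology.res (W.twistedTorsionGaloisModule p κ J u' hu') (v.adicCompletion K) 1 y')
  have h3 : galoisCohomology.map
      ((wJ.restrictField (v.adicCompletion K)).restrictField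
        (IsNonarchimedeanLocalField.maxUnramified (v.adicCompletion K))) 1
      (galoisCohomology.res ((W.twistedTorsionGaloisModule p κ J u' hu').restrictField (v.adicCompletion K))
        (IsNonarchimedeanLocalField.maxUnramified (v.adicCompletion K)) 1
        (galoisCohomology.res (W.twistedTorsionGaloisModule p κ J u' hu') (v.adicCompletion K) 1 y')) = 0 := by
    rw [← h2]
    have h1' := congrArg (galoisCohomology.res
      (((W.twistedTorsionGaloisModule p κ J u hu).tateDual (p ^ J)).restrictField (v.adicCompletion K))
      (IsNonarchimedeanLocalField.maxUnramified (v.adicCompletion K)) 1) h1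
    rw [← h1']
    exact hyv
  refine map_injective_of_leftInverse
    ((wJ.restrictField (v.adicCompletion K)).restrictField
      (IsNonarchimedeanLocalField.maxUnramified (v.adicCompletion K)))
    ((wI.restrictField (v.adicCompletion K)).restrictField
      (IsNonarchimedeanLocalField.maxUnramified (v.adicCompletion K)))
    (fun m ↦ W.twistedWeilDualInv_apply p κ J hu hu' huu' e hμ hadd₁ hadd₂ hgal hnondeg m) ?_
  rw [h3, map_zero]

/-- **At a good place `v ∉ S₀`, `v ∤ p` (cyclotomic tower): `twistedTorsionToH1 y'` is Kummer at `v` over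
`K_∞`** — unramified (file XX `twistedTorsionToH1_mem_unramifiedKer`) hence Kummer
(`Rank1Residual.Additive.unramKer_le_localKerOver_of_isCyclotomic`, any reduction at `v ∤ p`).
[cite: GreenbergVatsal2000, §2 p. 17] [cite: GreenbergLNM1716, §2 pp. 69–72] -/
theorem twistedTorsionToH1_mem_localKerOver_of_mem_dualSelmer (hκ : κ.IsCyclotomic)
    {inv : LocalInvariants K (p ^ J)} (hUO : inv.UnramifiedOrthogonal)
    (y' : galoisCohomology (W.twistedTorsionGaloisModule p κ J u' hu') 1)
    (hy : galoisCohomology.map (W.twistedWeilDual p κ J hu hu' huu' e hμ hadd₁ hadd₂ hgal) 1 y' ∈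
      (inv.dualSelmerStructure (W.twistedTorsionGaloisModule p κ J u hu)
        (W.twistedKummerSelmerStructure p S₀ κ J u hu)).selmerGroup)
    {v : HeightOneSpectrum (𝓞 K)} (hv : v ∉ S₀) (hpv : ((p : ℕ) : 𝓞 K) ∉ v.asIdeal)
    (hpJ : ((p ^ J : ℕ) : 𝓞 K) ∉ v.asIdeal)
    (hur : GaloisRep.IsUnramifiedAt v (W.twistedTorsionGaloisModule p κ J u hu)) :
    W.twistedTorsionToH1 p κ J u' hu' y' ∈ W.localKerOver p κ.kerSubgroup (v.adicCompletion K) := by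
  have hmem : W.twistedTorsionToH1 p κ J u' hu' y' ∈
      GreenbergVatsal2000.unramifiedKer κ.kerSubgroup (W.geomPrimaryTorsion p) v :=
    twistedTorsionToH1_mem_unramifiedKer W p κ J u' hu' v y'
      (res_mem_unramifiedSubgroup_of_mem_dualSelmer W p κ S₀ J hu hu' huu' e hμ hadd₁ hadd₂ hgal hnondeg
        hUO y' hy hv hpv hpJ hur)
  exact Summit.BirchSwinnertonDyer.Rank1Residual.Additive.unramKer_le_localKerOver_of_isCyclotomic
    (κ := κ) (W := W) (p := p) (v := v) hκ hpv hmem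

/-! ## Assembly: `twistedTorsionToH1 y' ∈ Sel_{p^∞}(E/K_∞)` -/

/-- **Dual-side control.** Let `inv` have `IsPerfect` and `UnramifiedOrthogonal`, `κ` be CYCLOTOMIC, and
`E[p^J](χ_u)` unramified with `p^J ∉ v` outside `S = {∞} ∪ S₀ ∪ {v ∣ p}`. Let
`y = H¹(w) y' ∈ H¹_{𝓕^*}(K, E[p^J](χ_u)^D)`. If the local classes of `y'` die in `H¹((K_∞)_w, E)` at the places
above `p` (`hδp`) and at the infinite places (`hδinf`) — the two remaining pieces of local arithmetic — then
`twistedTorsionToH1 y' ∈ Sel_{p^∞}(E/K_∞)`: Kummer at `S₀` (strict: local class `0`), at the good places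
(unramified ⇒ Kummer), at `p` and `∞` (hypotheses), and at all conjugate places
(`conjH1_twistedTorsionToH1_mem`). Greenberg p. 124: the dual Selmer classes live in
`S_{M^*}(F_∞) = Sel ⊗ κ^{-s}`. [cite: GreenbergLNM1716, §4 pp. 123–124] [cite: GreenbergVatsal2000, §2 pp. 16–17] -/
theorem twistedTorsionToH1_mem_selmerInfty_of_mem_dualSelmer (hκ : κ.IsCyclotomic)
    (hS : ∀ v : HeightOneSpectrum (𝓞 K), (Sum.inr v : Place K) ∉ twistedDescentPlaces (K := K) p S₀ →
      ((p ^ J : ℕ) : 𝓞 K) ∉ v.asIdeal ∧ GaloisRep.IsUnramifiedAt v (W.twistedTorsionGaloisModule p κ J u hu))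
    {inv : LocalInvariants K (p ^ J)} (hperf : inv.IsPerfect) (hUO : inv.UnramifiedOrthogonal)
    (y' : galoisCohomology (W.twistedTorsionGaloisModule p κ J u' hu') 1)
    (hy : galoisCohomology.map (W.twistedWeilDual p κ J hu hu' huu' e hμ hadd₁ hadd₂ hgal) 1 y' ∈
      (inv.dualSelmerStructure (W.twistedTorsionGaloisModule p κ J u hu)
        (W.twistedKummerSelmerStructure p S₀ κ J u hu)).selmerGroup)
    (hδp : ∀ v : HeightOneSpectrum (𝓞 K), ((p : ℕ) : 𝓞 K) ∈ v.asIdeal →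
      W.twistedTorsionToLocalH1 p κ J u' hu' (v.adicCompletion K)
        (galoisCohomology.res (W.twistedTorsionGaloisModule p κ J u' hu') (v.adicCompletion K) 1 y') = 0)
    (hδinf : ∀ w : InfinitePlace K,
      W.twistedTorsionToLocalH1 p κ J u' hu' w.Completion
        (galoisCohomology.res (W.twistedTorsionGaloisModule p κ J u' hu') w.Completion 1 y') = 0) :
    W.twistedTorsionToH1 p κ J u' hu' y' ∈ W.selmerInfty κ := by
  set c := W.twistedTorsionToH1 p κ J u' hu' y' with hc
  -- Kummer at every finite place (chosen place), then all conjugates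
  have hfin : ∀ v : HeightOneSpectrum (𝓞 K), c ∈ W.localKerOver p κ.kerSubgroup (v.adicCompletion K) := by
    intro v
    by_cases hvS : v ∈ S₀
    · rw [WeierstrassCurve.mem_localKerOver_iff, hc, W.localResOver_twistedTorsionToH1 p κ J u' hu',
        res_eq_zero_of_mem_dualSelmer W p κ S₀ J hu hu' huu' e hμ hadd₁ hadd₂ hgal hnondeg hperf y' hy hvS,
        map_zero]
    · by_cases hpv : ((p : ℕ) : 𝓞 K) ∈ v.asIdeal
      · rw [WeierstrassCurve.mem_localKerOver_iff, hc, W.localResOver_twistedTorsionToH1 p κ J u' hu']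
        exact hδp v hpv
      · have hvS' : (Sum.inr v : Place K) ∉ twistedDescentPlaces (K := K) p S₀ :=
          (not_mem_twistedDescentPlaces_iff p S₀ v).2 ⟨hvS, hpv⟩
        exact twistedTorsionToH1_mem_localKerOver_of_mem_dualSelmer W p κ S₀ J hu hu' huu' e hμ hadd₁ hadd₂
          hgal hnondeg hκ hUO y' hy hvS hpv (hS v hvS').1 (hS v hvS').2
  have hinf : ∀ w : InfinitePlace K, c ∈ W.localKerOver p κ.kerSubgroup w.Completion := fun w ↦ by
    rw [WeierstrassCurve.mem_localKerOver_iff, hc, W.localResOver_twistedTorsionToH1 p κ J u' hu']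
    exact hδinf w
  show c ∈ W.selmerGroupOver p κ.kerSubgroup
  rw [W.mem_selmerGroupOver_iff p κ.kerSubgroup]
  exact ⟨fun v σ ↦ W.conjH1_twistedTorsionToH1_mem p κ J u' hu' _ y' (hfin v) σ,
    fun w σ ↦ W.conjH1_twistedTorsionToH1_mem p κ J u' hu' _ y' (hinf w) σ⟩

end Weil

end Summit.BirchSwinnertonDyer.BirchSwinnertonDyer.Theorems.MultTransportTwistedDescent

end
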